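import Summits.CriticalPhenomena.Ising3DConformalLimit.Theorems.PrecisionLaplacianDirectCorrelationStableTailPickInversionAux

/-!
# Pick inversion, auxiliary file 2: Poisson approximate identity and the Poisson
# representation of an even continuous function with Hausdorff cosine moments

Helper file for stub `stub_pickInversion` of line `self-energy-pick-inversion`, crux
`PrecisionLaplacian.DirectCorrelationStableTail` (stmt-CriticalPhenomena-4799). Pure theorem file.

* `tendsto_integral_poisson_mul` : `∫_{-π}^{π} P_r(θ - φ) f(φ) dφ → 2π f(θ)` as `r ↑ 1`
  (`f` continuous, `2π`-periodic): the Poisson kernel is an approximate identity;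
* `two_pi_mul_eq_integral_poisson` (registered sub-goal `stub_pickInversion_auxPoissonRepr`): an
  even continuous `2π`-periodic `g` whose cosine moments are the moments of a finite positive
  measure `μ` on `[0, 1]` satisfies `2π g(θ) = ∫ P_t(θ) dμ(t)` whenever `cos θ ≠ 1` (Abel
  summation); first step of the Pick inversion of the slab modes of the direct correlation
  function. References: standard (Katznelson, *Harmonic analysis*, Ch. I).
-/

noncomputable section

namespace Summit.CriticalPhenomena.Ising3DConformalLimit.Cruxes.DirectCorrelationStableTail.SelfEnergyPickInversion

open MeasureTheory Filter Topology Set Real intervalIntegral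
open scoped BigOperators

/-! ### The Poisson kernel as an approximate identity -/

/-- The off-peak values of the Poisson kernel tend to zero: `P_r(δ) → 0` as `r ↑ 1`, for
`cos δ ≠ 1`. [folklore] -/
theorem tendsto_poisson_at_one {δ : ℝ} (hδ : Real.cos δ ≠ 1) :
    Tendsto (fun r : ℝ => (1 - r ^ 2) / (1 - 2 * r * Real.cos δ + r ^ 2)) (𝓝[<] 1) (𝓝 0) := by
  have hden1 : (1 - 2 * (1 : ℝ) * Real.cos δ + 1 ^ 2) ≠ 0 := by
    intro h
    apply hδ
    linarith
  have hcont : ContinuousAt (fun r : ℝ => (1 - r ^ 2) / (1 - 2 * r * Real.cos δ + r ^ 2)) 1 := by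
    refine ContinuousAt.div (by fun_prop) (by fun_prop) hden1
  have h := hcont.tendsto
  simp only [one_pow, sub_self, zero_div] at h
  exact h.mono_left nhdsWithin_le_nhds

/-- **Poisson approximate identity.** For `f : ℝ → ℝ` continuous and `2π`-periodic and every `θ`,
`∫_{-π}^{π} P_r(θ - φ) f(φ) dφ → 2π f(θ)` as `r ↑ 1`. [folklore] -/
theorem tendsto_integral_poisson_mul {f : ℝ → ℝ} (hf : Continuous f)
    (hper : Function.Periodic f (2 * π)) (θ : ℝ) :
    Tendsto (fun r : ℝ => ∫ φ in (-π)..π,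
        (1 - r ^ 2) / (1 - 2 * r * Real.cos (θ - φ) + r ^ 2) * f φ) (𝓝[<] 1)
      (𝓝 (2 * π * f θ)) := by
  -- a bound for `f`
  obtain ⟨M, hM⟩ : ∃ M : ℝ, ∀ x, |f x| ≤ M := by
    obtain ⟨M, hM⟩ := (isCompact_Icc (a := -π) (b := π)).exists_bound_of_continuousOn hf.continuousOn
    refine ⟨M, fun x => ?_⟩
    obtain ⟨k, hk⟩ : ∃ k : ℤ, x - k • (2 * π) ∈ Icc (-π) π := by
      refine ⟨toIcoDiv Real.two_pi_pos (-π) x, ?_⟩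
      have h := toIcoMod_mem_Ico Real.two_pi_pos (-π) x
      rw [toIcoMod] at h
      exact ⟨h.1, by linarith [h.2]⟩
    have hfx : f (x - k • (2 * π)) = f x := hper.sub_zsmul_eq k
    rw [← hfx, ← Real.norm_eq_abs]
    exact hM _ hk
  have hM0 : 0 ≤ M := le_trans (abs_nonneg _) (hM 0)
  rw [Metric.tendsto_nhdsWithin_nhds]
  intro ε hε
  -- continuity of `f` at `θ`
  obtain ⟨δ₀, hδ₀, hδ₀f⟩ := Metric.continuous_iff.mp hf θ (ε / (4 * π)) (by positivity)
  set δ : ℝ := min δ₀ (π / 2) with hδdef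
  have hδpos : 0 < δ := lt_min hδ₀ (by positivity)
  have hcosδ : Real.cos δ ≠ 1 := by
    rw [← Real.cos_zero]
    exact (Real.cos_lt_cos_of_nonneg_of_le_pi_div_two le_rfl (min_le_right _ _) hδpos).ne
  -- choose `r` close to `1` so that the off-peak kernel is small
  obtain ⟨η, hη, hηP⟩ := (Metric.tendsto_nhdsWithin_nhds.mp (tendsto_poisson_at_one hcosδ))
    (ε / (8 * π * M + 1)) (by positivity)
  refine ⟨min η 1, lt_min hη one_pos, fun r hr1 hrη => ?_⟩
  have hr1' : r < 1 := hr1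
  have hr0 : 0 < r := by
    have : dist r 1 < 1 := lt_of_lt_of_le hrη (min_le_right _ _)
    rw [Real.dist_eq, abs_lt] at this
    linarith
  have hr : |r| < 1 := by rw [abs_of_pos hr0]; exact hr1'
  have hPδ : (1 - r ^ 2) / (1 - 2 * r * Real.cos δ + r ^ 2) < ε / (8 * π * M + 1) := by
    have := hηP hr1 (lt_of_lt_of_le hrη (min_le_left _ _))
    rwa [Real.dist_eq, sub_zero, abs_of_nonneg (poisson_nonneg hr δ)] at this
  -- Step 1: shift the integral by periodicity: `∫ P_r(θ - φ) f φ dφ = ∫ P_r(u) f(θ - u) du`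
  set P : ℝ → ℝ := fun u => (1 - r ^ 2) / (1 - 2 * r * Real.cos u + r ^ 2) with hPdef
  have hPcont : Continuous P := continuous_poisson hr
  have hPper : Function.Periodic P (2 * π) := fun u => by
    simp only [hPdef, Real.cos_add_two_pi]
  have hshift : ∫ φ in (-π)..π, P (θ - φ) * f φ = ∫ u in (-π)..π, P u * f (θ - u) := by
    have h1 : ∫ φ in (-π)..π, P (θ - φ) * f φ = ∫ u in (θ - π)..(θ + π), P u * f (θ - u) := by
      have hg : ∀ φ, P (θ - φ) * f φ = (fun u => P u * f (θ - u)) (θ - φ) := by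
        intro φ; simp only [sub_sub_cancel]
      simp_rw [hg]
      rw [intervalIntegral.integral_comp_sub_left (fun u => P u * f (θ - u)) θ,
        show θ - -π = θ + π by ring]
    have hper2 : Function.Periodic (fun u => P u * f (θ - u)) (2 * π) := by
      intro u
      simp only
      rw [hPper, show θ - (u + 2 * π) = θ - u - 2 * π by ring, hper.sub_eq]
    have := hper2.intervalIntegral_add_eq (θ - π) (-π)
    rwa [show θ - π + 2 * π = θ + π by ring, show -π + 2 * π = π by ring, ← h1] at this
  rw [Real.dist_eq, hshift]
  -- Step 2: subtract `2π f θ = ∫ P_r(u) f(θ) du`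
  have hmass : ∫ u in (-π)..π, P u = 2 * π := integral_poisson hr0.le hr1'
  have hint1 : IntervalIntegrable (fun u => P u * f (θ - u)) volume (-π) π :=
    (hPcont.mul (hf.comp (continuous_const.sub continuous_id))).intervalIntegrable _ _
  have hint2 : IntervalIntegrable (fun u => P u * f θ) volume (-π) π :=
    (hPcont.mul continuous_const).intervalIntegrable _ _
  have hdiff : (∫ u in (-π)..π, P u * f (θ - u)) - 2 * π * f θ =
      ∫ u in (-π)..π, P u * (f (θ - u) - f θ) := by
    rw [← hmass, ← intervalIntegral.integral_mul_const, ← intervalIntegral.integral_sub hint1 hint2]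
    congr 1; ext u; ring
  rw [hdiff]
  -- Step 3: pointwise bound of the integrand by `P u * ε/(4π) + P_r(δ) * 2M`
  have hbound : ∀ u ∈ Set.uIoc (-π) π, |P u * (f (θ - u) - f θ)| ≤
      P u * (ε / (4 * π)) + (ε / (8 * π * M + 1)) * (2 * M) := by
    intro u hu
    have hu' : |u| ≤ π := by
      rw [Set.uIoc_of_le (by linarith [Real.pi_pos])] at hu
      exact abs_le.mpr ⟨hu.1.le, hu.2⟩
    have hPu : 0 ≤ P u := poisson_nonneg hr u
    rw [abs_mul, abs_of_nonneg hPu]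
    by_cases hcase : |u| < δ
    · have h1 : |f (θ - u) - f θ| ≤ ε / (4 * π) := by
        have : dist (θ - u) θ < δ₀ := by
          rw [Real.dist_eq, show θ - u - θ = -u by ring, abs_neg]
          exact lt_of_lt_of_le hcase (min_le_left _ _)
        have := hδ₀f (θ - u) this
        rw [Real.dist_eq] at this
        exact this.le
      calc P u * |f (θ - u) - f θ| ≤ P u * (ε / (4 * π)) := by gcongr
        _ ≤ P u * (ε / (4 * π)) + (ε / (8 * π * M + 1)) * (2 * M) := by
          have : 0 ≤ (ε / (8 * π * M + 1)) * (2 * M) := by positivity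
          linarith
    · push Not at hcase
      have h1 : P u ≤ ε / (8 * π * M + 1) :=
        le_trans (poisson_le_of_le_abs hr0.le hr1' hδpos.le hcase hu') hPδ.le
      have h2 : |f (θ - u) - f θ| ≤ 2 * M := by
        calc |f (θ - u) - f θ| ≤ |f (θ - u)| + |f θ| := abs_sub _ _
          _ ≤ M + M := add_le_add (hM _) (hM _)
          _ = 2 * M := by ring
      calc P u * |f (θ - u) - f θ| ≤ (ε / (8 * π * M + 1)) * (2 * M) := by gcongr
        _ ≤ P u * (ε / (4 * π)) + (ε / (8 * π * M + 1)) * (2 * M) := by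
          have : 0 ≤ P u * (ε / (4 * π)) := by positivity
          linarith
  have hle := intervalIntegral.abs_integral_le_integral_abs (a := -π) (b := π) (μ := volume)
    (f := fun u => P u * (f (θ - u) - f θ)) (by linarith [Real.pi_pos])
  have hint3 : IntervalIntegrable (fun u => |P u * (f (θ - u) - f θ)|) volume (-π) π :=
    (hint1.sub hint2).abs.congr (fun u _ => by simp only [mul_sub])
  have hint4 : IntervalIntegrable (fun u => P u * (ε / (4 * π)) + (ε / (8 * π * M + 1)) * (2 * M))
      volume (-π) π :=
    ((hPcont.mul continuous_const).add continuous_const).intervalIntegrable _ _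
  have hle2 := intervalIntegral.integral_mono_on_of_le_Ioo (by linarith [Real.pi_pos]) hint3 hint4
    (fun u hu => hbound u (by
      rw [Set.uIoc_of_le (by linarith [Real.pi_pos])]; exact ⟨hu.1, hu.2.le⟩))
  have hval : ∫ u in (-π)..π, (P u * (ε / (4 * π)) + (ε / (8 * π * M + 1)) * (2 * M)) =
      2 * π * (ε / (4 * π)) + (ε / (8 * π * M + 1)) * (2 * M) * (π - (-π)) := by
    have hi : IntervalIntegrable (fun u => P u * (ε / (4 * π))) volume (-π) π :=
      (hPcont.mul continuous_const).intervalIntegrable _ _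
    rw [intervalIntegral.integral_add hi intervalIntegrable_const,
      intervalIntegral.integral_mul_const, hmass,
      intervalIntegral.integral_const, smul_eq_mul]
    ring
  rw [hval] at hle2
  have hfinal : 2 * π * (ε / (4 * π)) + (ε / (8 * π * M + 1)) * (2 * M) * (π - (-π)) < ε := by
    have hπ := Real.pi_pos
    have h1 : 2 * π * (ε / (4 * π)) = ε / 2 := by field_simp; ring
    have h2 : (ε / (8 * π * M + 1)) * (2 * M) * (π - (-π)) = ε * (4 * π * M / (8 * π * M + 1)) := by
      field_simp; ring
    have h3 : 4 * π * M / (8 * π * M + 1) < 1 / 2 := by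
      rw [div_lt_div_iff₀ (by positivity) (by norm_num)]
      nlinarith
    rw [h1, h2]
    nlinarith
  calc |∫ u in (-π)..π, P u * (f (θ - u) - f θ)|
      ≤ ∫ u in (-π)..π, |P u * (f (θ - u) - f θ)| := hle
    _ ≤ _ := hle2
    _ < ε := hfinal

/-! ### From Hausdorff cosine moments to the Poisson representation -/

/-- A uniform bound for the Poisson kernel at a fixed angle off the peak: for `0 ≤ ρ < 1` and
`cos θ ≠ 1`, `P_ρ(θ) ≤ 4 + 1/(1 - cos θ)`. [folklore] -/
theorem poisson_le_const {ρ θ : ℝ} (hρ0 : 0 ≤ ρ) (hρ1 : ρ < 1) (hθ : Real.cos θ ≠ 1) :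
    (1 - ρ ^ 2) / (1 - 2 * ρ * Real.cos θ + ρ ^ 2) ≤ 4 + 1 / (1 - Real.cos θ) := by
  have hc : 0 < 1 - Real.cos θ := lt_of_le_of_ne (by linarith [Real.cos_le_one θ]) (by grind)
  have hnum : 1 - ρ ^ 2 ≤ 1 := by nlinarith
  have hinv : 0 ≤ 1 / (1 - Real.cos θ) := by positivity
  by_cases hcase : ρ ≤ 1 / 2
  · -- `den ≥ (1 - ρ)² ≥ 1/4`
    have hd : 1 / 4 ≤ 1 - 2 * ρ * Real.cos θ + ρ ^ 2 := by nlinarith [Real.cos_le_one θ]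
    calc (1 - ρ ^ 2) / (1 - 2 * ρ * Real.cos θ + ρ ^ 2) ≤ 1 / (1 / 4) :=
          div_le_div₀ zero_le_one hnum (by norm_num) hd
      _ ≤ 4 + 1 / (1 - Real.cos θ) := by linarith
  · -- `den ≥ 2ρ(1 - cos θ) ≥ 1 - cos θ`
    push Not at hcase
    have hd : 1 - Real.cos θ ≤ 1 - 2 * ρ * Real.cos θ + ρ ^ 2 := by nlinarith [Real.cos_le_one θ]
    calc (1 - ρ ^ 2) / (1 - 2 * ρ * Real.cos θ + ρ ^ 2) ≤ 1 / (1 - Real.cos θ) :=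
          div_le_div₀ zero_le_one hnum hc hd
      _ ≤ 4 + 1 / (1 - Real.cos θ) := by linarith

/-- **Poisson representation from Hausdorff cosine moments.** Let `g : ℝ → ℝ` be continuous, even and
`2π`-periodic, and let `μ` be a finite positive measure on `[0, 1]` with
`∫_{-π}^{π} g(θ) cos(nθ) dθ = ∫ tⁿ dμ(t)` for all `n : ℕ`. Then for every `θ` with `cos θ ≠ 1`,
`2π g(θ) = ∫ (1 - t²)/(1 - 2t cos θ + t²) dμ(t)`. (Abel summation: for `0 < r < 1` both
`∫ P_{rt}(θ) dμ(t)` and `∫_{-π}^{π} P_r(θ - φ) g(φ) dφ` equal `m₀ + 2∑_{n≥1} rⁿ mₙ cos(nθ)`;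
the first tends to the right-hand side by dominated convergence, the second to `2π g(θ)` by the
approximate identity.) [folklore] -/
theorem two_pi_mul_eq_integral_poisson {g : ℝ → ℝ} (hg : Continuous g)
    (hper : Function.Periodic g (2 * π)) (heven : ∀ θ, g (-θ) = g θ)
    {μ : Measure ℝ} [IsFiniteMeasure μ] (hμ : μ (Set.Icc (0 : ℝ) 1)ᶜ = 0)
    (hmom : ∀ n : ℕ, ∫ θ in (-π)..π, g θ * Real.cos (n * θ) = ∫ t, t ^ n ∂μ)
    {θ : ℝ} (hθ : Real.cos θ ≠ 1) :
    2 * π * g θ = ∫ t, (1 - t ^ 2) / (1 - 2 * t * Real.cos θ + t ^ 2) ∂μ := by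
  have hπ := Real.pi_pos
  have hae : ∀ᵐ t ∂μ, t ∈ Set.Icc (0 : ℝ) 1 := by
    rw [ae_iff]
    simpa only [Set.mem_setOf_eq, ← Set.mem_compl_iff, Set.setOf_mem_eq] using hμ
  -- a bound for `g` on `[-π, π]`
  obtain ⟨M, hM⟩ : ∃ M : ℝ, ∀ φ ∈ Set.Icc (-π) π, |g φ| ≤ M := by
    obtain ⟨M, hM⟩ := (isCompact_Icc (a := -π) (b := π)).exists_bound_of_continuousOn hg.continuousOn
    exact ⟨M, fun φ hφ => by rw [← Real.norm_eq_abs]; exact hM φ hφ⟩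
  have hM0 : 0 ≤ M := le_trans (abs_nonneg _) (hM 0 ⟨by linarith, by linarith⟩)
  -- the two Abel means
  set A : ℝ → ℝ := fun r => ∫ t, (1 - (r * t) ^ 2) / (1 - 2 * (r * t) * Real.cos θ + (r * t) ^ 2) ∂μ
    with hA
  set B : ℝ → ℝ := fun r => ∫ φ in (-π)..π,
    (1 - r ^ 2) / (1 - 2 * r * Real.cos (θ - φ) + r ^ 2) * g φ with hB
  -- Claim 1: `A r = B r` for `0 < r < 1` (both are `m₀ + ∑ 2 r^{n+1} cos((n+1)θ) m_{n+1}`)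
  have claim1 : ∀ r : ℝ, 0 < r → r < 1 → A r = B r := by
    intro r hr0 hr1
    have hr : |r| < 1 := by rw [abs_of_pos hr0]; exact hr1
    have hgeo : Summable fun n : ℕ => 2 * r ^ (n + 1) := by
      have := (summable_geometric_of_lt_one hr0.le hr1).mul_left (2 * r)
      refine this.congr fun n => ?_
      ring
    -- the series for `A r - m₀`
    have hL : HasSum (fun n : ℕ => ∫ t, 2 * (r * t) ^ (n + 1) * Real.cos ((n + 1 : ℕ) * θ) ∂μ)
        (∫ t, ((1 - (r * t) ^ 2) / (1 - 2 * (r * t) * Real.cos θ + (r * t) ^ 2) - 1) ∂μ) := by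
      refine hasSum_integral_of_dominated_convergence (fun n _ => 2 * r ^ (n + 1))
        (fun n => (Continuous.aestronglyMeasurable (by fun_prop))) ?_ ?_ ?_ ?_
      · intro n
        filter_upwards [hae] with t ht
        rw [Real.norm_eq_abs, abs_mul, abs_mul, abs_of_nonneg (by norm_num : (0:ℝ) ≤ 2), mul_pow,
          abs_mul, abs_of_nonneg (pow_nonneg hr0.le _), abs_of_nonneg (pow_nonneg ht.1 _)]
        have h1 : t ^ (n + 1) ≤ 1 := pow_le_one₀ ht.1 ht.2
        have h2 := Real.abs_cos_le_one ((n + 1 : ℕ) * θ)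
        have h3 : 0 ≤ 2 * r ^ (n + 1) := by positivity
        calc 2 * (r ^ (n + 1) * t ^ (n + 1)) * |Real.cos ((n + 1 : ℕ) * θ)|
            ≤ 2 * (r ^ (n + 1) * 1) * 1 := by gcongr
          _ = 2 * r ^ (n + 1) := by ring
      · exact Eventually.of_forall fun t => hgeo
      · exact integrable_const _
      · filter_upwards [hae] with t ht
        have hrt : |r * t| < 1 := by
          rw [abs_mul, abs_of_pos hr0, abs_of_nonneg ht.1]
          calc r * t ≤ r * 1 := by gcongr; exact ht.2
            _ < 1 := by linarith
        exact hasSum_poisson_sub_one hrt θ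
    have hLterm : ∀ n : ℕ, ∫ t, 2 * (r * t) ^ (n + 1) * Real.cos ((n + 1 : ℕ) * θ) ∂μ =
        2 * r ^ (n + 1) * Real.cos ((n + 1 : ℕ) * θ) * ∫ t, t ^ (n + 1) ∂μ := by
      intro n
      rw [← MeasureTheory.integral_const_mul]
      congr 1; ext t; rw [mul_pow]; ring
    -- the series for `B r - m₀`
    have hR : HasSum (fun n : ℕ => ∫ φ in (-π)..π,
        2 * r ^ (n + 1) * Real.cos ((n + 1 : ℕ) * (θ - φ)) * g φ)
        (∫ φ in (-π)..π, ((1 - r ^ 2) / (1 - 2 * r * Real.cos (θ - φ) + r ^ 2) - 1) * g φ) := by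
      refine intervalIntegral.hasSum_integral_of_dominated_convergence (fun n _ => 2 * r ^ (n + 1) * M)
        (fun n => (Continuous.aestronglyMeasurable (by fun_prop))) ?_ ?_ ?_ ?_
      · intro n
        filter_upwards with φ hφ
        rw [Set.uIoc_of_le (by linarith)] at hφ
        rw [Real.norm_eq_abs, abs_mul, abs_mul, abs_mul, abs_of_nonneg (by norm_num : (0:ℝ) ≤ 2),
          abs_of_nonneg (pow_nonneg hr0.le _)]
        have h1 := Real.abs_cos_le_one ((n + 1 : ℕ) * (θ - φ))
        have h2 := hM φ ⟨hφ.1.le, hφ.2⟩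
        have h3 : 0 ≤ 2 * r ^ (n + 1) := by positivity
        calc 2 * r ^ (n + 1) * |Real.cos ((n + 1 : ℕ) * (θ - φ))| * |g φ|
            ≤ 2 * r ^ (n + 1) * 1 * M := by gcongr
          _ = 2 * r ^ (n + 1) * M := by ring
      · exact Eventually.of_forall fun φ _ => hgeo.mul_right M
      · exact intervalIntegrable_const
      · filter_upwards with φ _
        exact (hasSum_poisson_sub_one hr (θ - φ)).mul_right _
    have hRterm : ∀ n : ℕ, ∫ φ in (-π)..π, 2 * r ^ (n + 1) * Real.cos ((n + 1 : ℕ) * (θ - φ)) * g φ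
        = 2 * r ^ (n + 1) * Real.cos ((n + 1 : ℕ) * θ) * ∫ t, t ^ (n + 1) ∂μ := by
      intro n
      have hexp : ∀ φ : ℝ, 2 * r ^ (n + 1) * Real.cos ((n + 1 : ℕ) * (θ - φ)) * g φ =
          (2 * r ^ (n + 1) * Real.cos ((n + 1 : ℕ) * θ)) * (g φ * Real.cos ((n + 1 : ℕ) * φ)) +
          (2 * r ^ (n + 1) * Real.sin ((n + 1 : ℕ) * θ)) * (g φ * Real.sin ((n + 1 : ℕ) * φ)) := by
        intro φ
        rw [mul_sub, Real.cos_sub]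
        ring
      simp_rw [hexp]
      rw [intervalIntegral.integral_add, intervalIntegral.integral_const_mul,
        intervalIntegral.integral_const_mul, hmom (n + 1), integral_even_mul_sin heven]
      · ring
      · exact ((hg.mul (by fun_prop)).intervalIntegrable _ _).const_mul _
      · exact ((hg.mul (by fun_prop)).intervalIntegrable _ _).const_mul _
    -- the two series coincide termwise
    have hsame : (fun n : ℕ => ∫ t, 2 * (r * t) ^ (n + 1) * Real.cos ((n + 1 : ℕ) * θ) ∂μ) =
        fun n : ℕ => ∫ φ in (-π)..π, 2 * r ^ (n + 1) * Real.cos ((n + 1 : ℕ) * (θ - φ)) * g φ := by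
      funext n; rw [hLterm, hRterm]
    rw [hsame] at hL
    have hdiff := hL.unique hR
    -- the zeroth moments: `∫ 1 dμ = m₀ = ∫ g`
    have hm0 : ∫ φ in (-π)..π, g φ = ∫ t, (1 : ℝ) ∂μ := by
      have := hmom 0
      simpa using this
    -- integrability facts
    have hintA : Integrable (fun t => (1 - (r * t) ^ 2) / (1 - 2 * (r * t) * Real.cos θ + (r * t) ^ 2)) μ := by
      refine Integrable.mono' (integrable_const (4 + 1 / (1 - Real.cos θ)))
        (Measurable.aestronglyMeasurable (by fun_prop)) ?_
      · filter_upwards [hae] with t ht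
        have hrt0 : 0 ≤ r * t := mul_nonneg hr0.le ht.1
        have hrt1 : r * t < 1 := by
          calc r * t ≤ r * 1 := by gcongr; exact ht.2
            _ < 1 := by linarith
        rw [Real.norm_eq_abs, abs_of_nonneg (poisson_nonneg (by rwa [abs_of_nonneg hrt0]) θ)]
        exact poisson_le_const hrt0 hrt1 hθ
    have hPcont : Continuous fun φ => (1 - r ^ 2) / (1 - 2 * r * Real.cos (θ - φ) + r ^ 2) :=
      Continuous.div continuous_const (by fun_prop) fun φ => (poisson_den_pos hr (θ - φ)).ne'
    have hint2 : Integrable (fun t => (1 - (r * t) ^ 2) / (1 - 2 * (r * t) * Real.cos θ + (r * t) ^ 2) - 1) μ :=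
      hintA.sub (integrable_const 1)
    have hA' : A r = (∫ t, ((1 - (r * t) ^ 2) / (1 - 2 * (r * t) * Real.cos θ + (r * t) ^ 2) - 1) ∂μ)
        + ∫ t, (1 : ℝ) ∂μ := by
      rw [← integral_add hint2 (integrable_const 1)]
      simp only [hA]
      exact integral_congr_ae (ae_of_all _ fun t => by ring)
    have hB' : B r = (∫ φ in (-π)..π, ((1 - r ^ 2) / (1 - 2 * r * Real.cos (θ - φ) + r ^ 2) - 1) * g φ)
        + ∫ φ in (-π)..π, g φ := by
      rw [hB]; simp only
      rw [← intervalIntegral.integral_add]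
      · congr 1; ext φ; ring
      · exact ((hPcont.sub continuous_const).mul hg).intervalIntegrable _ _
      · exact hg.intervalIntegrable _ _
    rw [hA', hB', hdiff, hm0]
  -- Claim 2: `B r → 2π g θ`
  have claim2 : Tendsto B (𝓝[<] 1) (𝓝 (2 * π * g θ)) := tendsto_integral_poisson_mul hg hper θ
  -- Claim 3: `A r → ∫ P_t(θ) dμ` (dominated convergence)
  have claim3 : Tendsto A (𝓝[<] 1)
      (𝓝 (∫ t, (1 - t ^ 2) / (1 - 2 * t * Real.cos θ + t ^ 2) ∂μ)) := by
    refine tendsto_integral_filter_of_dominated_convergence (fun _ => 4 + 1 / (1 - Real.cos θ))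
      ?_ ?_ (integrable_const _) ?_
    · exact Eventually.of_forall fun r => Measurable.aestronglyMeasurable (by fun_prop)
    · have hev : ∀ᶠ r in 𝓝[<] (1 : ℝ), r ∈ Set.Ioo (0 : ℝ) 1 :=
        Ioo_mem_nhdsLT (by norm_num)
      filter_upwards [hev] with r hr
      filter_upwards [hae] with t ht
      have hrt0 : 0 ≤ r * t := mul_nonneg hr.1.le ht.1
      have hrt1 : r * t < 1 := by
        calc r * t ≤ r * 1 := mul_le_mul_of_nonneg_left ht.2 hr.1.le
          _ < 1 := by linarith [hr.2]
      rw [Real.norm_eq_abs, abs_of_nonneg (poisson_nonneg (by rwa [abs_of_nonneg hrt0]) θ)]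
      exact poisson_le_const hrt0 hrt1 hθ
    · filter_upwards [hae] with t ht
      -- continuity of `r ↦ P_{rt}(θ)` at `r = 1`
      have hden1 : 1 - 2 * (1 * t) * Real.cos θ + (1 * t) ^ 2 ≠ 0 := by
        rcases ht.2.lt_or_eq with h1 | h1
        · have : |1 * t| < 1 := by rw [one_mul, abs_of_nonneg ht.1]; exact h1
          exact (poisson_den_pos this θ).ne'
        · rw [h1]
          intro h
          apply hθ
          nlinarith
      have hcont : ContinuousAt (fun r : ℝ =>
          (1 - (r * t) ^ 2) / (1 - 2 * (r * t) * Real.cos θ + (r * t) ^ 2)) 1 :=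
        ContinuousAt.div (by fun_prop) (by fun_prop) hden1
      have h := hcont.tendsto
      simp only [one_mul] at h
      exact h.mono_left nhdsWithin_le_nhds
  -- conclusion: the two limits of `A = B` (eventually) coincide
  have hAB : A =ᶠ[𝓝[<] 1] B := by
    have hev : ∀ᶠ r in 𝓝[<] (1 : ℝ), r ∈ Set.Ioo (0 : ℝ) 1 := Ioo_mem_nhdsLT (by norm_num)
    filter_upwards [hev] with r hr
    exact claim1 r hr.1 hr.2
  have claim3' : Tendsto B (𝓝[<] 1) (𝓝 (∫ t, (1 - t ^ 2) / (1 - 2 * t * Real.cos θ + t ^ 2) ∂μ)) :=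
    claim3.congr' hAB
  exact tendsto_nhds_unique claim2 claim3'

/-- **Registered auxiliary stub `stub_pickInversion_auxPoissonRepr`** (sub-goal of
`stub_pickInversion`): the Poisson representation `2π g(θ) = ∫ P_t(θ) dμ(t)` (`cos θ ≠ 1`) of an
even continuous `2π`-periodic `g` whose cosine moments are the moments of a finite positive measure
`μ` on `[0, 1]` (`two_pi_mul_eq_integral_poisson`). [folklore] -/
theorem stub_pickInversion_auxPoissonRepr : ∀ (g : ℝ → ℝ) (μ : MeasureTheory.Measure ℝ),
    Continuous g → Function.Periodic g (2 * Real.pi) → (∀ θ : ℝ, g (-θ) = g θ) →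
    MeasureTheory.IsFiniteMeasure μ → μ (Set.Icc (0 : ℝ) 1)ᶜ = 0 →
    (∀ n : ℕ, ∫ θ in (-Real.pi)..Real.pi, g θ * Real.cos (n * θ) = ∫ t, t ^ n ∂μ) →
    ∀ θ : ℝ, Real.cos θ ≠ 1 →
      2 * Real.pi * g θ = ∫ t, (1 - t ^ 2) / (1 - 2 * t * Real.cos θ + t ^ 2) ∂μ :=
  fun _ _ hg hper heven hfin hμ hmom _ hθ =>
    haveI := hfin
    two_pi_mul_eq_integral_poisson hg hper heven hμ hmom hθ

end Summit.CriticalPhenomena.Ising3DConformalLimit.Cruxes.DirectCorrelationStableTail.SelfEnergyPickInversion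

end
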